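import Summits.CriticalPhenomena.PercolationContinuityZ3.Theorems.FK.TwoPointFunctionTailFK
import Summits.CriticalPhenomena.PercolationContinuityZ3.Theorems.FK.ThetaIdentification
import Summits.CriticalPhenomena.PercolationContinuityZ3.Theorems.FK.FreeEdwardsSokalTwoPoint
import Summits.CriticalPhenomena.PercolationContinuityZ3.Theorems.FK.InfiniteVolumeCylinders
import Summits.CriticalPhenomena.PercolationContinuityZ3.Theorems.FK.FreeEdwardsSokalLROIdentity
import HarnessLib

/-!
# Uniform mixing bounds for free box limits, and Grimmett's (5.18) at `q = 2`:
# `⟨σ_0σ_u⟩^∅_β → θ⁰(1 - e^{-2β}, 2)²` as `|u| → ∞`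

fk-continuity build cell, row FO-03b⁵ (re-scoped by the coordinator's one-home ruling R32(2):
"quantitative uniform mixing + `φ⁰` two-point corollaries of `TwoPointFunctionTailFK.lean` at `q = 2`";
`--supports stmt-CriticalPhenomena-4575`, helper); builds on p205010 (kernel theorem, internal audit signed;
external expert review pending). Sorry-free, standard axioms, no named facts, no new definitions.

The cell's `TwoPointFunctionTailFK.lean` (row FO-08e) proves, for a box limit `P` with the DLR sandwich
property (`FKGibbs`) and translation invariance, the covariance estimate
`|P(A ∩ C) - P(A) P(C)| ≤ P(A) - φ⁰_Λ(A)` (`FKGibbs.abs_real_inter_sub_mul_le_sub_regionFreeReal`), mixing on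
local events along `|v| → ∞` (`IsBoxLimit.tendsto_real_inter_preimage_shift_cofinite`, Grimmett 2006
Cor. (4.23)) and (5.32) `P(0 ↔ u) → P(0 ↔ ∞)²` (`IsBoxLimit.tendsto_real_openConn_cofinite`). This file adds
only what is not there:

* `FK.FKGibbs.abs_real_inter_setOf_subset_sub_mul_le` — the covariance estimate for the increasing
  cylinders `{E ⊆ ω}`, `E` any finite set of pairs inside `Λ_m` (pairs that are not lattice edges are
  almost surely closed, so both sides vanish), with the free box law `φ⁰_{Λ_m}` on the right;
* `FK.FKGibbs.uniformMixing_cylEvent`, **`FK.FKGibbs.uniformMixing_isLocalEvent`** — the QUANTITATIVE,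
  UNIFORM form of mixing for a FREE box limit: for every local event `A` and `ε > 0` there is `m₀` such that
  `|P(A ∩ H) - P(A) P(H)| ≤ ε` for every `m ≥ m₀` and EVERY event `H` determined by finitely many pairs off
  `E_{Λ_m}` — uniform in `H` (inclusion–exclusion over the cylinders of `A`, one prescribed-closed pair at a
  time as in `InfiniteVolumeCylinders.lean`, and `φ⁰_{Λ_m}(U) ↑ P(U)` on increasing cylinders);
* **`FK.IsBoxLimit.tendsto_twoPointFree_cofinite`** — **Grimmett 2006 Thm. (5.17) eq. (5.18) at `q = 2`,
  literally: `⟨σ_0σ_u⟩^∅_{β,0} → θ⁰(1 - e^{-2β}, 2)²` as `|u| → ∞`** (i.e.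
  `½ θ⁰(p,2)² = lim_{|u|→∞} {π_β(σ_0 = σ_u) - ½}`), for every free FK–Ising box limit `P` that is an FK Gibbs
  measure, translation invariant, with a.s. at most one infinite cluster: (5.32) for `P` (row FO-08e),
  infinite-volume Edwards–Sokal `⟨σ_0σ_u⟩^∅ = P(0 ↔ u)` (`FreeEdwardsSokalTwoPoint.lean`) and
  `P(0 ↔ ∞) = θ⁰(p,2)` (`ThetaIdentification.lean`, row FO-07); no positive-association input;
  `FK.IsBoxLimit.tendsto_freePair_cofinite_of_fkGibbs` is the same in the `P(0 ↔ ∞)` normalisation.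

The hypotheses `hG : FKGibbs d p q P`, `hT`, `huniq` are, for `P = rcLimit d false p q`, the conclusions of the
cell's `IsBoxLimit.fkGibbs` (`InfiniteVolumeDLR.lean`), `IsBoxLimit.measurePreserving_relabel_shift`
(`InfiniteVolumeInvariance.lean`) and `IsBoxLimit.ae_numInfiniteClusters_le_one` (row FO-08); the discharged
`rcLimit` statements are assembled in `FreeEdwardsSokalRcLimit.lean`.

## References

* G. Grimmett, *The Random-Cluster Model*, Springer 2006: Lemma (4.13), Lemma (4.14)(b), Thm. (4.19)(a),(d),
  Cor. (4.23); Thm. (5.17) with the proof of (5.18), (5.32), p. 107. [Grimmett2006]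
-/

noncomputable section

namespace Summit.CriticalPhenomena.PercolationContinuityZ3.Theorems

namespace FK

open MeasureTheory Finset Filter Topology Function
open Literature.Probability.LatticeModels Literature.Barriers.CriticalPhenomena
open Literature.Probability.Percolation

variable {d : ℕ}

/-! ### The covariance estimate for increasing cylinders -/

section Sandwich

variable {p q : ℝ} {P : Measure (BondConfig (Site d))}

/-- **Covariance estimate for the increasing cylinder `{E ⊆ ω}`** of a finite set `E` of pairs inside the
box `Λ_m` (`0 ≤ p ≤ 1`, `q > 0`), for a measure with the DLR sandwich property:
`|P({E ⊆ ω} ∩ H) - P(E ⊆ ω) P(H)| ≤ P(E ⊆ ω) - φ⁰_{Λ_m,p,q}(E ⊆ ω)` for every `H` determined by finitely many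
pairs off `E_{Λ_m}` (the cell's `FKGibbs.abs_real_inter_sub_mul_le_sub_regionFreeReal` when all pairs of `E`
are lattice edges; otherwise both sides vanish, `P` and the box laws being carried by lattice
configurations). [cite: Grimmett2006, Thm. (4.19)(d) (proof, p. 79)] -/
theorem FKGibbs.abs_real_inter_setOf_subset_sub_mul_le (hG : FKGibbs d p q P)
    (hp : p ∈ Set.Icc (0 : ℝ) 1) (hq : 0 < q) {E : Finset (Sym2 (Site d))} {m : ℕ}
    (hE : ∀ e ∈ E, ∀ z ∈ e, z ∈ box d m) (T : Finset (Sym2 (Site d)))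
    (hT : Disjoint (↑T : Set (Sym2 (Site d))) ↑(edgesIn (zdGraph d) (box d m)))
    {H : Set (BondConfig (Site d))} (hH : DeterminedBy H ↑T) :
    |P.real ({ω | (↑E : Set (Sym2 (Site d))) ⊆ ω} ∩ H) -
        P.real {ω | (↑E : Set (Sym2 (Site d))) ⊆ ω} * P.real H| ≤
      P.real {ω | (↑E : Set (Sym2 (Site d))) ⊆ ω} -
        (rcBoxLaw d false p q m).real {ω | (↑E : Set (Sym2 (Site d))) ⊆ ω} := by
  haveI := hG.isProbabilityMeasure
  set U : Set (BondConfig (Site d)) := {ω | (↑E : Set (Sym2 (Site d))) ⊆ ω} with hU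
  have hUm : MeasurableSet U := measurableSet_setOf_subset E
  by_cases hEE : ∀ e ∈ E, e ∈ (zdGraph d).edgeSet
  · -- all pairs of `E` are lattice edges of `Λ_m`: the sandwich bound of row FO-08e
    have hUup : IsUpperSet U := fun ω ω' hle hω => Set.Subset.trans hω hle
    have hUdet : DeterminedBy U ↑(edgesIn (zdGraph d) (box d m)) :=
      (determinedBy_setOf_subset E).mono fun e he =>
        Finset.mem_coe.2 (mem_edgesIn_iff.2 ⟨hEE e (Finset.mem_coe.1 he), hE e (Finset.mem_coe.1 he)⟩)
    have h := hG.abs_real_inter_sub_mul_le_sub_regionFreeReal (box d m) T hUup hUdet hT hH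
    rwa [regionFreeReal_box p q m hUm] at h
  · -- some pair of `E` is not a lattice edge: everything vanishes
    push Not at hEE
    obtain ⟨e, heE, he⟩ := hEE
    have hUsub : U ⊆ {ω : BondConfig (Site d) | e ∈ ω} := fun ω hω => hω (Finset.mem_coe.2 heE)
    have hPe : P {ω : BondConfig (Site d) | e ∈ ω} = 0 := by
      have h0 : P {ω : BondConfig (Site d) | ¬ω ⊆ (zdGraph d).edgeSet} = 0 := ae_iff.1 hG.ae_subset_edgeSet
      exact measure_mono_null (fun ω (hω : e ∈ ω) (hωE : ω ⊆ (zdGraph d).edgeSet) => he (hωE hω)) h0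
    have hPU : P.real U = 0 := by
      rw [measureReal_def, measure_mono_null hUsub hPe, ENNReal.toReal_zero]
    have hPUH : P.real (U ∩ H) = 0 := by
      rw [measureReal_def, measure_mono_null (Set.inter_subset_left.trans hUsub) hPe, ENNReal.toReal_zero]
    have hBU : (rcBoxLaw d false p q m).real U = 0 := by
      rw [measureReal_def, measure_mono_null hUsub (rcBoxLaw_setOf_mem_eq_zero_of_notMem false hp hq m he),
        ENNReal.toReal_zero]
    rw [hPUH, hPU, hBU]
    simp

end Sandwich

/-! ### Uniform mixing of free box limits on cylinders and on local events -/

section Uniform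

variable {p q : ℝ} {P : Measure (BondConfig (Site d))}

/-- **Uniform mixing on cylinder events** for a free box limit with the DLR sandwich property
(`0 ≤ p ≤ 1`, `q ≥ 1`): for the cylinder `C = C(F₀, S)` (pairs of `S` open, pairs of `F₀ ∖ S` closed) and
`ε > 0` there is `m₀` with `|P(C ∩ H) - P(C) P(H)| ≤ ε` for all `m ≥ m₀` and ALL `H` determined by finitely
many pairs off `E_{Λ_m}`. Induction on `|F₀ ∖ S|`: for `F₀ ⊆ S` the cylinder is increasing and the bound is
`P(C) - φ⁰_{Λ_m}(C) → 0` (`φ⁰_{Λ_m}(C) → P(C)`); otherwise split on one prescribed-closed pair,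
`C(F₀ ∖ {e₀}, S) = C(F₀, S) ⊔ C(F₀, S ∪ {e₀})`. [cite: Grimmett2006, Thm. (4.19)(d) and Cor. (4.23), with §4.1 (cylinder events)] -/
theorem FKGibbs.uniformMixing_cylEvent (hG : FKGibbs d p q P) (hP : IsBoxLimit d false p q P)
    (hp : p ∈ Set.Icc (0 : ℝ) 1) (hq : 1 ≤ q) (F₀ S : Finset (Sym2 (Site d))) {ε : ℝ} (hε : 0 < ε) :
    ∃ m₀ : ℕ, ∀ m, m₀ ≤ m → ∀ T : Finset (Sym2 (Site d)),
      Disjoint (↑T : Set (Sym2 (Site d))) ↑(edgesIn (zdGraph d) (box d m)) →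
      ∀ H : Set (BondConfig (Site d)), DeterminedBy H ↑T →
        |P.real (cylEvent F₀ S ∩ H) - P.real (cylEvent F₀ S) * P.real H| ≤ ε := by
  classical
  haveI := hG.isProbabilityMeasure
  have hq0 : 0 < q := one_pos.trans_le hq
  -- induction on the number of prescribed-closed pairs
  suffices HH : ∀ k : ℕ, ∀ F₀ S : Finset (Sym2 (Site d)), (F₀ \ S).card = k → ∀ ε : ℝ, 0 < ε →
      ∃ m₀ : ℕ, ∀ m, m₀ ≤ m → ∀ T : Finset (Sym2 (Site d)),
        Disjoint (↑T : Set (Sym2 (Site d))) ↑(edgesIn (zdGraph d) (box d m)) →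
        ∀ H : Set (BondConfig (Site d)), DeterminedBy H ↑T →
          |P.real (cylEvent F₀ S ∩ H) - P.real (cylEvent F₀ S) * P.real H| ≤ ε from
    HH _ F₀ S rfl ε hε
  intro k
  induction k with
  | zero =>
    intro F₀ S hk ε hε
    rw [Finset.card_eq_zero, Finset.sdiff_eq_empty_iff_subset] at hk
    rw [cylEvent_eq_setOf_subset hk]
    -- `φ⁰_{Λ_m}(F₀ ⊆ ω) → P(F₀ ⊆ ω)`
    have hlim := hP.tendsto_real (isLocalEvent_setOf_subset F₀)
    obtain ⟨m₁, hm₁⟩ := (Metric.tendsto_atTop.1 hlim) ε hε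
    refine ⟨max m₁ (F₀.sup pairRad), fun m hm T hT H hH => ?_⟩
    have hmE : ∀ e ∈ F₀, ∀ z ∈ e, z ∈ box d m :=
      forall_mem_box_of_sup_pairRad_le (le_of_max_le_right hm)
    refine (hG.abs_real_inter_setOf_subset_sub_mul_le hp hq0 hmE T hT hH).trans ?_
    have h := hm₁ m (le_of_max_le_left hm)
    rw [Real.dist_eq, abs_lt] at h
    linarith [h.1]
  | succ k ih =>
    intro F₀ S hk ε hε
    obtain ⟨e₀, he₀⟩ : (F₀ \ S).Nonempty := by
      rw [← Finset.card_pos, hk]; exact Nat.succ_pos k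
    rw [Finset.mem_sdiff] at he₀
    obtain ⟨he₀E, he₀S⟩ := he₀
    have hk1 : (F₀.erase e₀ \ S).card = k := by
      rw [Finset.erase_sdiff_comm, Finset.card_erase_of_mem (Finset.mem_sdiff.2 ⟨he₀E, he₀S⟩), hk]
      rfl
    have hk2 : (F₀ \ insert e₀ S).card = k := by
      rw [Finset.sdiff_insert, Finset.card_erase_of_mem (Finset.mem_sdiff.2 ⟨he₀E, he₀S⟩), hk]
      rfl
    obtain ⟨m₁, hm₁⟩ := ih (F₀.erase e₀) S hk1 (ε / 2) (half_pos hε)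
    obtain ⟨m₂, hm₂⟩ := ih F₀ (insert e₀ S) hk2 (ε / 2) (half_pos hε)
    refine ⟨max m₁ m₂, fun m hm T hT H hH => ?_⟩
    have hHm : MeasurableSet H := hH.measurableSet_of_finset
    have h1 := hm₁ m (le_of_max_le_left hm) T hT H hH
    have h2 := hm₂ m (le_of_max_le_right hm) T hT H hH
    -- `P(C(F₀∖{e₀},S)) = P(C(F₀,S)) + P(C(F₀,S∪{e₀}))`, also after intersecting with `H`
    have hdisj : Disjoint (cylEvent F₀ S) (cylEvent F₀ (insert e₀ S)) := disjoint_cylEvent_insert he₀E he₀S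
    have heq : P.real (cylEvent (F₀.erase e₀) S) =
        P.real (cylEvent F₀ S) + P.real (cylEvent F₀ (insert e₀ S)) := by
      rw [cylEvent_erase_eq_union he₀S, measureReal_union hdisj (measurableSet_cylEvent _ _)]
    have heqH : P.real (cylEvent (F₀.erase e₀) S ∩ H) =
        P.real (cylEvent F₀ S ∩ H) + P.real (cylEvent F₀ (insert e₀ S) ∩ H) := by
      rw [cylEvent_erase_eq_union he₀S, Set.union_inter_distrib_right,
        measureReal_union (hdisj.mono Set.inter_subset_left Set.inter_subset_left)
          ((measurableSet_cylEvent _ _).inter hHm)]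
    rw [heq, heqH] at h1
    rw [abs_le] at h1 h2 ⊢
    constructor <;> nlinarith [h1.1, h1.2, h2.1, h2.2]

/-- **Uniform mixing on local events** for a free box limit with the DLR sandwich property (`0 ≤ p ≤ 1`,
`q ≥ 1`): for every local event `A` and `ε > 0` there is `m₀` with `|P(A ∩ H) - P(A) P(H)| ≤ ε` for all
`m ≥ m₀` and all events `H` determined by finitely many pairs off `E_{Λ_m}` — the estimate is uniform in `H`
(Grimmett 2006, Thm. (4.19)(d): `φ⁰_{p,q}` is tail-trivial; Cor. (4.23): mixing). `A` is the disjoint union of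
the cylinders `C(F, S)`, `S ⊆ F`, it contains. [cite: Grimmett2006, Thm. (4.19)(d) and Cor. (4.23)] -/
theorem FKGibbs.uniformMixing_isLocalEvent (hG : FKGibbs d p q P) (hP : IsBoxLimit d false p q P)
    (hp : p ∈ Set.Icc (0 : ℝ) 1) (hq : 1 ≤ q) {A : Set (BondConfig (Site d))} (hA : IsLocalEvent A)
    {ε : ℝ} (hε : 0 < ε) :
    ∃ m₀ : ℕ, ∀ m, m₀ ≤ m → ∀ T : Finset (Sym2 (Site d)),
      Disjoint (↑T : Set (Sym2 (Site d))) ↑(edgesIn (zdGraph d) (box d m)) →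
      ∀ H : Set (BondConfig (Site d)), DeterminedBy H ↑T →
        |P.real (A ∩ H) - P.real A * P.real H| ≤ ε := by
  classical
  haveI := hG.isProbabilityMeasure
  obtain ⟨F, hF⟩ := hA
  have hF' := (determinedBy_iff _ _).1 hF
  set 𝒯 : Finset (Finset (Sym2 (Site d))) := F.powerset.filter fun S => ((S : Set (Sym2 (Site d))) ∈ A)
    with h𝒯
  -- decomposition of `A` into the cylinders it contains
  have hdec : A = ⋃ S ∈ 𝒯, cylEvent F S := by
    ext ω
    simp only [Set.mem_iUnion, h𝒯, Finset.mem_filter, Finset.mem_powerset, exists_prop]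
    constructor
    · intro hω
      refine ⟨F.filter (· ∈ ω), ⟨Finset.filter_subset _ _, ?_⟩, ?_⟩
      · refine (hF' ω _ ?_).1 hω
        ext e
        simp only [Set.mem_inter_iff, Finset.mem_coe, Finset.coe_filter, Set.mem_setOf_eq]
        tauto
      · rw [mem_cylEvent_iff]
        intro e he
        simp only [Finset.mem_filter]
        tauto
    · rintro ⟨S, ⟨-, hSA⟩, hω⟩
      rw [mem_cylEvent_iff] at hω
      refine (hF' ω S ?_).2 hSA
      ext e
      simp only [Set.mem_inter_iff, Finset.mem_coe]
      exact ⟨fun h' => ⟨(hω e h'.2).1 h'.1, h'.2⟩, fun h' => ⟨(hω e h'.2).2 h'.1, h'.2⟩⟩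
  have hdisj : (𝒯 : Set (Finset (Sym2 (Site d)))).PairwiseDisjoint fun S => cylEvent F S := by
    intro S hS S' hS' hne
    have hSF : S ⊆ F := Finset.mem_powerset.1 (Finset.mem_filter.1 hS).1
    have hS'F : S' ⊆ F := Finset.mem_powerset.1 (Finset.mem_filter.1 hS').1
    exact disjoint_cylEvent_of_ne hSF hS'F hne
  -- one `m_S` per cylinder, for the tolerance `ε / (|𝒯| + 1)`
  have hN : (0 : ℝ) < 𝒯.card + 1 := Nat.cast_add_one_pos _
  have hε' : 0 < ε / (𝒯.card + 1) := div_pos hε hN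
  choose mS hmS using fun S : Finset (Sym2 (Site d)) => hG.uniformMixing_cylEvent hP hp hq F S hε'
  refine ⟨𝒯.sup mS, fun m hm T hT H hH => ?_⟩
  have hHm : MeasurableSet H := hH.measurableSet_of_finset
  have hsum : P.real A = ∑ S ∈ 𝒯, P.real (cylEvent F S) := by
    rw [hdec]
    exact measureReal_biUnion_finset hdisj fun S _ => measurableSet_cylEvent F S
  have hsumH : P.real (A ∩ H) = ∑ S ∈ 𝒯, P.real (cylEvent F S ∩ H) := by
    rw [hdec, Set.iUnion₂_inter]
    exact measureReal_biUnion_finset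
      (fun S hS S' hS' hne => (hdisj hS hS' hne).mono Set.inter_subset_left Set.inter_subset_left)
      fun S _ => (measurableSet_cylEvent F S).inter hHm
  have hterm : ∀ S ∈ 𝒯, |P.real (cylEvent F S ∩ H) - P.real (cylEvent F S) * P.real H| ≤
      ε / (𝒯.card + 1) := fun S hS =>
    hmS S m ((Finset.le_sup hS).trans hm) T hT H hH
  rw [hsumH, hsum, Finset.sum_mul, ← Finset.sum_sub_distrib]
  refine (Finset.abs_sum_le_sum_abs _ _).trans ?_
  refine (Finset.sum_le_sum hterm).trans ?_
  rw [Finset.sum_const, nsmul_eq_mul]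
  have hc : (0 : ℝ) ≤ 𝒯.card := Nat.cast_nonneg _
  rw [mul_div_assoc', div_le_iff₀ hN]
  nlinarith [hε.le, hc]

end Uniform

/-! ### `q = 2`: Grimmett's Thm. (5.17) eq. (5.18), literally -/

section Ising

variable {β : ℝ} {P : Measure (BondConfig (Site d))}

/-- **Grimmett 2006, Thm. (5.17) eq. (5.18) at `q = 2`: `⟨σ_0σ_u⟩^∅_{β,0} → θ⁰(1 - e^{-2β}, 2)²` as
`|u| → ∞` in `ℤ^d`** — i.e. `½ θ⁰(p,2)² = lim_{|u|→∞} {π_β(σ_0 = σ_u) - ½}` with `p = 1 - e^{-2β}`, `β ≥ 0`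
— for every free FK–Ising box limit `P` which is an FK Gibbs measure, translation invariant, and has almost
surely at most one infinite cluster (for `P = φ⁰_{p,2}` these are Grimmett 2006 Thm. (4.17)(a)/(4.19)(b) and
the Burton–Keane theorem, supplied by the cell's construction files and row FO-08). Proof:
(5.32) for `P` (`IsBoxLimit.tendsto_real_openConn_cofinite`, row FO-08e), infinite-volume Edwards–Sokal
`⟨σ_0σ_u⟩^∅ = P(0 ↔ u)` (`FreeEdwardsSokalTwoPoint.lean`) and `P(0 ↔ ∞) = θ⁰(p,2)` (row FO-07). No
positive-association input. [cite: Grimmett2006, Thm. (5.17), eq. (5.18) and its proof, (5.32), p. 107] [cite: EdwardsSokal1988] -/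
theorem IsBoxLimit.tendsto_twoPointFree_cofinite (hP : IsBoxLimit d false (fkIsingParam β) 2 P)
    (hβ : 0 ≤ β) (hG : FKGibbs d (fkIsingParam β) 2 P)
    (hT : ∀ v : Site d, MeasurePreserving (BondConfig.relabel (sym2Equiv (Site.shift v))) P P)
    (huniq : ∀ᵐ ω ∂P, numInfiniteClusters ω ≤ 1) :
    Tendsto (twoPointFree d β) cofinite (𝓝 (thetaFree d (fkIsingParam β) 2 ^ 2)) := by
  have hp : fkIsingParam β ∈ Set.Icc (0 : ℝ) 1 := fkIsingParam_mem_Icc hβ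
  have h := hP.tendsto_real_openConn_cofinite hG hT hp two_pos huniq
  rw [hP.real_percolatesAt_eq_thetaFree hp (by norm_num)] at h
  refine h.congr fun u => ?_
  rw [hP.real_openConn_eq_freePair hβ 0 u, freePair_zero_left]

/-- The same in the `P(0 ↔ ∞)` normalisation and for the pair correlation `⟨σ_0σ_u⟩^∅ = freePair d β 0 u`:
`freePair d β 0 u → P(0 ↔ ∞)²` as `|u| → ∞` (hypotheses as above; compare
`IsBoxLimit.tendsto_freePair_cofinite` of `FreeEdwardsSokalPointwise.lean`, which assumes positive association
in place of the FK Gibbs property for the lower half). [cite: Grimmett2006, Thm. (5.17), eq. (5.18) and its proof, (5.32), p. 107] -/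
theorem IsBoxLimit.tendsto_freePair_cofinite_of_fkGibbs (hP : IsBoxLimit d false (fkIsingParam β) 2 P)
    (hβ : 0 ≤ β) (hG : FKGibbs d (fkIsingParam β) 2 P)
    (hT : ∀ v : Site d, MeasurePreserving (BondConfig.relabel (sym2Equiv (Site.shift v))) P P)
    (huniq : ∀ᵐ ω ∂P, numInfiniteClusters ω ≤ 1) :
    Tendsto (fun u : Site d => freePair d β 0 u) cofinite (𝓝 (P.real (percolatesAt (0 : Site d)) ^ 2)) := by
  have h := hP.tendsto_real_openConn_cofinite hG hT (fkIsingParam_mem_Icc hβ) two_pos huniq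
  exact h.congr fun u => hP.real_openConn_eq_freePair hβ 0 u

end Ising

/-! ### The LRO identity `M̃_LRO(β)² = θ⁰(1 - e^{-2β}, 2)²` over a free box limit (appended): (5.18) at `q = 2`
in ADS15's Cesàro normalisation, upper half from iterate mixing (no uniqueness), lower half from Cauchy–Schwarz +
uniqueness (no Gibbs property), `P(0 ↔ ∞) = θ⁰(p,2)` by row FO-07; `rcLimit` forms: `FreeEdwardsSokalRcLimit.lean`. -/

section LROTheta

variable {p q : ℝ} {β : ℝ} {P : Measure (BondConfig (Site d))}

/-- For a nonzero `v ∈ ℤ^d`, `k ↦ k • v` tends to the cofinite filter (it is injective). [folklore] -/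
theorem tendsto_nsmul_atTop_cofinite {v : Site d} (hv : v ≠ 0) :
    Tendsto (fun k : ℕ => k • v) atTop cofinite := by
  obtain ⟨i, hi⟩ : ∃ i, v i ≠ 0 := by
    by_contra h
    push Not at h
    exact hv (funext h)
  have hinj : Injective fun k : ℕ => k • v := by
    intro k k' hkk'
    have h := congrFun hkk' i
    simp only [Pi.smul_apply, nsmul_eq_mul] at h
    exact_mod_cast mul_right_cancel₀ hi h
  rw [← Nat.cofinite_eq_atTop]
  exact hinj.tendsto_cofinite

/-- **Mixing along the iterates of one shift** for a translation-invariant FREE box limit with the DLR sandwich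
property (`0 ≤ p ≤ 1`, `q ≥ 1`, `v ≠ 0`): `P(A ∩ T_v^{-k} B) → P(A) P(B)` for local `A, B` — the cofinite mixing
of row FO-08e (`IsBoxLimit.tendsto_real_inter_preimage_shift_cofinite`) along `k ↦ k • v`
(`iterate_relabel_shift`). This is the hypothesis `hmix` of `IsBoxLimit.lroTildeSq_le_sq_real_percolatesAt`.
[cite: Grimmett2006, Cor. (4.23)] -/
theorem IsBoxLimit.tendsto_real_inter_preimage_iterate_of_fkGibbs (hP : IsBoxLimit d false p q P)
    (hG : FKGibbs d p q P) (hp : p ∈ Set.Icc (0 : ℝ) 1) (hq : 1 ≤ q)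
    (hT : ∀ v : Site d, MeasurePreserving (BondConfig.relabel (sym2Equiv (Site.shift v))) P P)
    {v : Site d} (hv : v ≠ 0) {A B : Set (BondConfig (Site d))} (hA : IsLocalEvent A)
    (hB : IsLocalEvent B) :
    Tendsto (fun k : ℕ =>
        P.real (A ∩ (⇑(BondConfig.relabel (sym2Equiv (Site.shift v))))^[k] ⁻¹' B))
      atTop (𝓝 (P.real A * P.real B)) := by
  have h := (hP.tendsto_real_inter_preimage_shift_cofinite hG hT hp (one_pos.trans_le hq) hA hB).comp
    (tendsto_nsmul_atTop_cofinite hv)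
  refine h.congr fun k => ?_
  simp only [comp_apply, iterate_relabel_shift]

/-- **`M̃_LRO(β)² ≤ θ⁰(1 - e^{-2β}, 2)²` — the upper half of (5.18), WITHOUT uniqueness** (`d ≥ 1`, `β ≥ 0`):
for a free FK–Ising box limit `P` with the DLR sandwich property and translation invariance
(`IsBoxLimit.lroTildeSq_le_sq_real_percolatesAt` fed with the iterate mixing above, and `P(0 ↔ ∞) = θ⁰(p,2)`).
[cite: Grimmett2006, Thm. (5.17), proof of (5.18), (5.32), p. 107, with Cor. (4.23)] -/
theorem IsBoxLimit.lroTildeSq_le_thetaFree_sq (hP : IsBoxLimit d false (fkIsingParam β) 2 P) (hd : 1 ≤ d)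
    (hβ : 0 ≤ β) (hG : FKGibbs d (fkIsingParam β) 2 P)
    (hT : ∀ v : Site d, MeasurePreserving (BondConfig.relabel (sym2Equiv (Site.shift v))) P P) :
    lroTildeSq d β ≤ thetaFree d (fkIsingParam β) 2 ^ 2 := by
  have hp : fkIsingParam β ∈ Set.Icc (0 : ℝ) 1 := fkIsingParam_mem_Icc hβ
  have hq : (1 : ℝ) ≤ 2 := by norm_num
  rw [← hP.real_percolatesAt_eq_thetaFree hp hq]
  exact hP.lroTildeSq_le_sq_real_percolatesAt hd hβ (hG.ae_subset_edgeSet) hT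
    fun v hv A B hA hB => hP.tendsto_real_inter_preimage_iterate_of_fkGibbs hG hp hq hT hv hA hB

/-- **`θ⁰(1 - e^{-2β}, 2)² ≤ M̃_LRO(β)²` — the lower half of (5.18), WITHOUT the Gibbs property** (`β ≥ 0`):
translation invariance and a.s. uniqueness of the infinite cluster suffice (Cauchy–Schwarz density bound,
`IsBoxLimit.sq_real_percolatesAt_le_lroTildeSq`, and `P(0 ↔ ∞) = θ⁰(p,2)`).
[cite: Grimmett2006, Thm. (5.17), proof of (5.18), (5.32), p. 107] [cite: AizenmanDuminilCopinSidoraviciusCMP2015, Thm. 3.1] -/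
theorem IsBoxLimit.thetaFree_sq_le_lroTildeSq (hP : IsBoxLimit d false (fkIsingParam β) 2 P) (hβ : 0 ≤ β)
    (hT : ∀ v : Site d, MeasurePreserving (BondConfig.relabel (sym2Equiv (Site.shift v))) P P)
    (huniq : ∀ᵐ ω ∂P, numInfiniteClusters ω ≤ 1) :
    thetaFree d (fkIsingParam β) 2 ^ 2 ≤ lroTildeSq d β := by
  rw [← hP.real_percolatesAt_eq_thetaFree (fkIsingParam_mem_Icc hβ) (by norm_num)]
  exact hP.sq_real_percolatesAt_le_lroTildeSq hβ hT huniq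

/-- **`M̃_LRO(β)² = θ⁰(1 - e^{-2β}, 2)²` — Grimmett 2006 Thm. (5.17) eq. (5.18) at `q = 2` in the Cesàro
normalisation of ADS15 §1.3** (`d ≥ 1`, `β ≥ 0`), for every free FK–Ising box limit `P` with the DLR sandwich
property, translation invariance and a.s. uniqueness of the infinite cluster: the variant long-range order
parameter of the free Ising state IS the free FK–Ising percolation probability. For `P = φ⁰_{p,2}` the three
hypotheses are Grimmett 2006 Lemma (4.13)/(4.14)(b), Thm. (4.19)(b) and Thm. (4.33)(c) (the cell's
`IsBoxLimit.fkGibbs`, `.measurePreserving_relabel_shift`, `.ae_numInfiniteClusters_le_one`).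
[cite: Grimmett2006, Thm. (5.17), eq. (5.18), p. 102 (proof p. 107)] [cite: AizenmanDuminilCopinSidoraviciusCMP2015, §1.3, eq. (1.9)] -/
theorem IsBoxLimit.lroTildeSq_eq_thetaFree_sq (hP : IsBoxLimit d false (fkIsingParam β) 2 P) (hd : 1 ≤ d)
    (hβ : 0 ≤ β) (hG : FKGibbs d (fkIsingParam β) 2 P)
    (hT : ∀ v : Site d, MeasurePreserving (BondConfig.relabel (sym2Equiv (Site.shift v))) P P)
    (huniq : ∀ᵐ ω ∂P, numInfiniteClusters ω ≤ 1) :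
    lroTildeSq d β = thetaFree d (fkIsingParam β) 2 ^ 2 :=
  le_antisymm (hP.lroTildeSq_le_thetaFree_sq hd hβ hG hT) (hP.thetaFree_sq_le_lroTildeSq hβ hT huniq)

/-- **`θ⁰(1 - e^{-2β}, 2)² ≤ ⟨σ_xσ_y⟩^∅_{β,0}` for all `x, y`** (`β ≥ 0`): the lower half of (5.32), pointwise,
for a positively associated, translation-invariant free FK–Ising box limit with a.s. uniqueness
(`IsBoxLimit.sq_real_percolatesAt_le_freePair` and `P(0 ↔ ∞) = θ⁰(p,2)`).
[cite: Grimmett2006, Thm. (5.17), proof of (5.18), (5.32), p. 107] -/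
theorem IsBoxLimit.thetaFree_sq_le_freePair (hP : IsBoxLimit d false (fkIsingParam β) 2 P) (hβ : 0 ≤ β)
    (hPA : IsPositivelyAssociated P)
    (hT : ∀ v : Site d, MeasurePreserving (BondConfig.relabel (sym2Equiv (Site.shift v))) P P)
    (huniq : ∀ᵐ ω ∂P, numInfiniteClusters ω ≤ 1) (x y : Site d) :
    thetaFree d (fkIsingParam β) 2 ^ 2 ≤ freePair d β x y := by
  rw [← hP.real_percolatesAt_eq_thetaFree (fkIsingParam_mem_Icc hβ) (by norm_num)]
  exact hP.sq_real_percolatesAt_le_freePair hβ hPA hT huniq x y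

end LROTheta

end FK

end Summit.CriticalPhenomena.PercolationContinuityZ3.Theorems

end
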